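import Mathlib
import Literature.Barriers.MatrixMultiplication.NormalizerBarrier
import Literature.RepresentationTheory.FiniteGroups.IrreducibleCharacters
import Literature.RepresentationTheory.FiniteGroups.InducedClassFunction
import Literature.RepresentationTheory.FiniteGroups.BrauerInduction
import Summits.MatrixMultiplication.MatrixMultiplication.Theorems.LieRankDesigns.Negative.Basics
import Summits.MatrixMultiplication.MatrixMultiplication.Theorems.SubgroupIdentityDesigns.Negative.FlagNoGo
import Summits.MatrixMultiplication.MatrixMultiplication.Theorems.SubgroupIdentityDesigns.Negative.FlagTwistNoGo
import Summits.MatrixMultiplication.MatrixMultiplication.Theorems.SubgroupIdentityDesigns.Negative.BlockSliceSummary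
import Summits.MatrixMultiplication.MatrixMultiplication.Theorems.SubgroupIdentityDesigns.Negative.SteinbergTower
import Summits.MatrixMultiplication.MatrixMultiplication.Theorems.SubgroupIdentityDesigns.Negative.HookCharacter

/-!
# Block-slice no-go for ALL primes `p` and ALL `l ≥ 3`, conditional on the parabolic Mackey formula

Supports stmt-MatrixMultiplication-14079 (crux `SubgroupIdentityDesigns`, route `LevelGradedCohnUmans`;
BLOCK-SLICES §2).  VALUE = theorem (conditional), NOT summit progress.

`BlockSliceSummary.no_translate_witness` needs the regime hypothesis
`k = 1 ∨ k + 2 ≤ p ∨ (k+1)⁶ ≤ p^{l−3} ∨ 3 + 6⌈log₂(k+1)⌉ ≤ l`, leaving for each `k ≥ 2` the finite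
corner `p ≤ k + 1`, `3 ≤ l < 3 + 6⌈log₂(k+1)⌉` (`BlockSliceSummary.corner`).  The obstruction there was the
absence of `k` distinct non-trivial multiplicative characters of `𝔽_p`.  The **hook unipotent character**
`χ^{(l,1^k)} = Σ_{c ≤ k} (−1)^{k−c} I^{k+l}_c St_c` (`HookCharacter.hook`) needs no multiplicative
characters at all: it has level `k`, degree `p^{k(k+1)/2}[k+l−1,k]_p ≥ p^{kl} p^{k(k−1)/2}` and — granted the
maximal-parabolic Mackey formula `SteinbergTower.MackeyFormula (ZMod p) N'` for all `N' ≤ k + l` — norm `1`,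
hence is irreducible (`HookCharacter.isIrrChar_hook`).  Feeding it into
`FlagNoGo.not_budget_lt_of_char_translate` with the threshold `FlagTwistNoGo.threshold_three` gives:

* **`no_translate_witness`** / `no_slice_witness` / `no_slice_witness'` — CONDITIONAL on the Mackey
  formula: for `k ≥ 1`, `l ≥ 3`, EVERY prime `p`, every `ε > 0` and every subgroup-TPP triple of
  `GL_{k+l}(𝔽_p)` with products in a translate `x S_{k+l,k} y` of the block slice, the crux inequality FAILS;
* `no_translate_witness_corner` — the same with the Mackey formula required only in the residual corner
  (outside it `BlockSliceSummary.no_translate_witness` is unconditional).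

What remains for the unconditional statement is the single identity `MackeyFormula (ZMod p) N`
(`⟨I^N_c σ, I^N_j τ⟩ = Σ_i ⟨r^c_i σ, r^j_i τ⟩` over `max(0, c+j−N) ≤ i ≤ min(c, j)`), a statement about
`(P_c, P_j)`-double cosets in `GL_N(𝔽_q)`.
-/

set_option linter.dupNamespace false

noncomputable section

open scoped BigOperators Matrix Classical
open Literature.Barriers.MatrixMultiplication (SubgroupTPP)
open Literature.RepresentationTheory.FiniteGroups
open Summit.MatrixMultiplication.MatrixMultiplication.Theorems.LieRankDesigns.Negative

namespace Summit.MatrixMultiplication.MatrixMultiplication.Theorems.SubgroupIdentityDesigns.Negative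
namespace BlockSliceMackey

open FlagNoGo (not_budget_lt_of_char_translate)
open FlagTwistNoGo (threshold_three)
open SteinbergTower (MackeyFormula)
open HookCharacter (hook isIrrChar_hook hook_mem_levelSet hook_one_ne_zero hook_one_ge classInner_hook_hook)

variable {p : ℕ} [hp : Fact p.Prime] {k l : ℕ}

/-- **Block-slice no-go for all `p` and all `l ≥ 3`, CONDITIONAL on the parabolic Mackey formula**:
for every `ε > 0`, no subgroup-TPP triple of `GL_{k+l}(𝔽_p)` with products in a translate `x S_{k+l,k} y`
of the block slice satisfies the budget inequality of the crux `SubgroupIdentityDesigns`. -/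
theorem no_translate_witness (hM : ∀ N', N' ≤ k + l → MackeyFormula (ZMod p) N')
    (hk : 1 ≤ k) (hl : 3 ≤ l)
    {H₁ H₂ H₃ : Subgroup (GLm p (k + l))} (htpp : SubgroupTPP H₁ H₂ H₃) (x y : GLm p (k + l))
    (hS : ∀ a ∈ H₁, ∀ b ∈ H₂, ∀ c ∈ H₃, ∀ i j : Fin l,
      ((x⁻¹ * (a * b * c) * y⁻¹ : GLm p (k + l)) : Mat p (k + l)) (Fin.natAdd k i)
          (Fin.natAdd k j) = (1 : Matrix (Fin l) (Fin l) (ZMod p)) i j)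
    {ε : ℝ} (hε : 0 < ε) :
    ¬ ((∑ᶠ ψ ∈ irrChars (GLm p (k + l)) ∩ levelSet p (k + l) k, (ψ 1).re ^ (2 + ε)) <
        ((Nat.card H₁ * Nat.card H₂ * Nat.card H₃ : ℕ) : ℝ) ^ ((2 + ε) / 3)) := by
  have hl1 : 1 ≤ l := by omega
  exact not_budget_lt_of_char_translate hk (isIrrChar_hook hM hl1).isCharacter (hook_mem_levelSet hl1)
    (hook_one_ne_zero hl1) (c := 1)
    (D := (((p ^ (k * l) * p ^ (∑ i ∈ Finset.range k, i) : ℕ) : ℝ))) one_pos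
    (by rw [classInner_hook_hook hM hl1, Complex.one_re]) (Nat.cast_nonneg _) (hook_one_ge hl1)
    (threshold_three hl) htpp x y hS hε

/-- The block slice itself (`x = y = 1`), CONDITIONAL on the Mackey formula. -/
theorem no_slice_witness (hM : ∀ N', N' ≤ k + l → MackeyFormula (ZMod p) N')
    (hk : 1 ≤ k) (hl : 3 ≤ l)
    {H₁ H₂ H₃ : Subgroup (GLm p (k + l))} (htpp : SubgroupTPP H₁ H₂ H₃)
    (hS : ∀ a ∈ H₁, ∀ b ∈ H₂, ∀ c ∈ H₃, ∀ i j : Fin l,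
      ((a * b * c : GLm p (k + l)) : Mat p (k + l)) (Fin.natAdd k i) (Fin.natAdd k j) =
        (1 : Matrix (Fin l) (Fin l) (ZMod p)) i j)
    {ε : ℝ} (hε : 0 < ε) :
    ¬ ((∑ᶠ ψ ∈ irrChars (GLm p (k + l)) ∩ levelSet p (k + l) k, (ψ 1).re ^ (2 + ε)) <
        ((Nat.card H₁ * Nat.card H₂ * Nat.card H₃ : ℕ) : ℝ) ^ ((2 + ε) / 3)) :=
  no_translate_witness hM hk hl htpp 1 1
    (fun a ha b hb c hc i j => by simpa using hS a ha b hb c hc i j) hε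

/-- **Corner form**: the Mackey formula is needed only in the residual corner `k ≥ 2`, `p ≤ k + 1`,
`l < 3 + 6⌈log₂(k+1)⌉`; everywhere else `BlockSliceSummary.no_translate_witness` is unconditional. -/
theorem no_translate_witness_corner (hk : 1 ≤ k) (hl : 3 ≤ l)
    (hM : 2 ≤ k → p ≤ k + 1 → l < 3 + 6 * Nat.clog 2 (k + 1) →
      ∀ N', N' ≤ k + l → MackeyFormula (ZMod p) N')
    {H₁ H₂ H₃ : Subgroup (GLm p (k + l))} (htpp : SubgroupTPP H₁ H₂ H₃) (x y : GLm p (k + l))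
    (hS : ∀ a ∈ H₁, ∀ b ∈ H₂, ∀ c ∈ H₃, ∀ i j : Fin l,
      ((x⁻¹ * (a * b * c) * y⁻¹ : GLm p (k + l)) : Mat p (k + l)) (Fin.natAdd k i)
          (Fin.natAdd k j) = (1 : Matrix (Fin l) (Fin l) (ZMod p)) i j)
    {ε : ℝ} (hε : 0 < ε) :
    ¬ ((∑ᶠ ψ ∈ irrChars (GLm p (k + l)) ∩ levelSet p (k + l) k, (ψ 1).re ^ (2 + ε)) <
        ((Nat.card H₁ * Nat.card H₂ * Nat.card H₃ : ℕ) : ℝ) ^ ((2 + ε) / 3)) := by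
  by_cases hreg : k = 1 ∨ k + 2 ≤ p ∨ (k + 1) ^ 6 ≤ p ^ (l - 3) ∨ 3 + 6 * Nat.clog 2 (k + 1) ≤ l
  · exact BlockSliceSummary.no_translate_witness hk hl hreg htpp x y hS hε
  · obtain ⟨h2, hpk, hlog⟩ := BlockSliceSummary.corner (p := p) hk hreg
    exact no_translate_witness (hM h2 hpk hlog) hk hl htpp x y hS hε

/-- **Ambient form**, CONDITIONAL on the Mackey formula up to `m`: for `m ≥ k + 3`, `k ≥ 1`, writing
`m = k + l`, the block slice `S_{m,k}` carries no witness of the crux inequality, for any prime `p` and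
any `ε > 0`. -/
theorem no_slice_witness' {m : ℕ} (hM : ∀ N', N' ≤ m → MackeyFormula (ZMod p) N') (hk : 1 ≤ k)
    (hm : k + 3 ≤ m) :
    ∃ l, m = k + l ∧ ∀ {H₁ H₂ H₃ : Subgroup (GLm p (k + l))}, SubgroupTPP H₁ H₂ H₃ →
      (∀ a ∈ H₁, ∀ b ∈ H₂, ∀ c ∈ H₃, ∀ i j : Fin l,
        ((a * b * c : GLm p (k + l)) : Mat p (k + l)) (Fin.natAdd k i) (Fin.natAdd k j) =
          (1 : Matrix (Fin l) (Fin l) (ZMod p)) i j) →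
      ∀ {ε : ℝ}, 0 < ε →
        ¬ ((∑ᶠ ψ ∈ irrChars (GLm p (k + l)) ∩ levelSet p (k + l) k, (ψ 1).re ^ (2 + ε)) <
            ((Nat.card H₁ * Nat.card H₂ * Nat.card H₃ : ℕ) : ℝ) ^ ((2 + ε) / 3)) :=
  ⟨m - k, by omega, fun htpp hS _ hε =>
    no_slice_witness (fun N' hN' => hM N' (by omega)) hk (by omega) htpp hS hε⟩

end BlockSliceMackey
end Summit.MatrixMultiplication.MatrixMultiplication.Theorems.SubgroupIdentityDesigns.Negative
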